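import Mathlib
import HarnessLib
import Literature.NumberTheory.Transcendental.AssociatorsAntipode
import Literature.NumberTheory.Transcendental.MZVDualIndex

/-!
# `KernelModuloPeriodConjecture`, line `Sketch`: the algebraic leaf is closed under duality

Crux `FurushoPentagon.KernelModuloPeriodConjecture` (stmt-KontsevichZagierPeriods-15058), line
`Sketch`, registered stub `stub_leafOfDual` (skeleton v9b, lead c3): if the dual index `τ(s)` of an
admissible index `s` has a Hoffman expansion valid at every group-like pentagon solution, then so has
`s` — by the duality theorem for pentagon solutions `c_{τ(w)}(φ) = (-1)^{|w|} c_w(φ)` (tree theorem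
`NCSeries.DrinfeldPentagon.apply_reverse_map_not`, Furusho's 2-cycle relation + the antipode of the
shuffle Hopf algebra; at `Φ_KZ` this is `ζ(τ(s)) = ζ(s)`) and `binaryWord (τ s) = τ(binaryWord s)`,
`weight (τ s) = weight s` (tree, `MZV.binaryWord_dual`, `MZV.weight_dual`). With it every landed family of
the leaf doubles: the duals `(2,1^{2c-2})ᵐ` of `{2c}ᵐ` (e.g. `ζ(2,1,…,1) = ζ(2n)`), and the duals of the
Hoffman words themselves (all words in the blocks `(2)`, `(2,1)`).

References: M. E. Hoffman, Pacific J. Math. 152 (1992) §3 p. 281–282 [Hoffman1992]; H. Furusho,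
Ann. of Math. 171 (2010) Lemma 6 [Furusho2010].
-/

namespace Summit.KontsevichZagierPeriods.FurushoPentagon.KernelModuloPeriodConjecture

open Literature.NumberTheory.Transcendental

/-- **Duality at a pentagon solution, index form**: for an admissible index `s`,
`c_{binaryWord (τ s)}(φ) = (-1)^{weight s} c_{binaryWord s}(φ)` at every group-like solution of
Drinfeld's pentagon. [cite: Furusho2010, Lemma 6] -/
theorem leafOfDual_apply_dual {R : Type} [CommRing R] [Algebra ℚ R] {φ : NCSeries Bool R}
    (hg : NCSeries.IsGroupLike φ) (h5 : NCSeries.DrinfeldPentagon φ) {s : List ℕ}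
    (hs : MZV.IsAdmissible s) :
    φ (MZV.binaryWord (MZV.dual s)) = (-1 : R) ^ MZV.weight s * φ (MZV.binaryWord s) := by
  rw [MZV.binaryWord_dual hs, ← hs.length_binaryWord]
  exact h5.apply_reverse_map_not hg (MZV.binaryWord s)

/-- **The algebraic leaf is closed under duality** (registered stub `stub_leafOfDual` of line
`Sketch`): a Hoffman expansion of `c_{binaryWord (τ s)}` valid at every group-like pentagon solution
over every reduced commutative `ℚ`-algebra gives one of `c_{binaryWord s}` (multiply by
`(-1)^{weight s}`). [cite: Hoffman1992, §3 p. 282] -/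
theorem stub_leafOfDual :
    ∀ s : List ℕ, MZV.IsAdmissible s →
      (∃ b : List ℕ →₀ ℚ, (∀ t ∈ b.support, MZV.IsHoffman t ∧ MZV.weight t = MZV.weight (MZV.dual s)) ∧ ∀ (R : Type) [CommRing R] [Algebra ℚ R] [IsReduced R] (φ : NCSeries Bool R), NCSeries.IsGroupLike φ → NCSeries.DrinfeldPentagon φ → φ (MZV.binaryWord (MZV.dual s)) = b.sum (fun t q => q • φ (MZV.binaryWord t))) →
      ∃ b : List ℕ →₀ ℚ, (∀ t ∈ b.support, MZV.IsHoffman t ∧ MZV.weight t = MZV.weight s) ∧ ∀ (R : Type) [CommRing R] [Algebra ℚ R] [IsReduced R] (φ : NCSeries Bool R), NCSeries.IsGroupLike φ → NCSeries.DrinfeldPentagon φ → φ (MZV.binaryWord s) = b.sum (fun t q => q • φ (MZV.binaryWord t)) := by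
  intro s hs ⟨b, hb, hφ⟩
  refine ⟨((-1 : ℚ) ^ MZV.weight s) • b, fun t ht => ?_, fun R _ _ _ φ hg h5 => ?_⟩
  · obtain ⟨h1, h2⟩ := hb t (Finsupp.support_smul ht)
    exact ⟨h1, h2.trans (MZV.weight_dual hs)⟩
  · have hd := leafOfDual_apply_dual hg h5 hs
    rw [hφ R φ hg h5] at hd
    have hsq : ((-1 : R) ^ MZV.weight s) * ((-1 : R) ^ MZV.weight s) = 1 := by
      rw [← pow_add, ← two_mul, pow_mul]
      simp
    calc φ (MZV.binaryWord s)
        = ((-1 : R) ^ MZV.weight s) * (((-1 : R) ^ MZV.weight s) * φ (MZV.binaryWord s)) := by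
          rw [← mul_assoc, hsq, one_mul]
      _ = ((-1 : R) ^ MZV.weight s) * b.sum (fun t q => q • φ (MZV.binaryWord t)) := by rw [hd]
      _ = (((-1 : ℚ) ^ MZV.weight s) • b).sum (fun t q => q • φ (MZV.binaryWord t)) := by
          rw [Finsupp.sum_smul_index' (h := fun t q => q • φ (MZV.binaryWord t))
            (fun t => zero_smul ℚ _), Finsupp.mul_sum]
          refine Finsupp.sum_congr fun t _ => ?_
          simp only [smul_eq_mul, Algebra.smul_def, map_mul, map_pow, map_neg, map_one, mul_assoc]

end Summit.KontsevichZagierPeriods.FurushoPentagon.KernelModuloPeriodConjecture
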